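import Summits.Ventures.CertifiedArithmetic.LowPrec.OptTreePolySigned

/-!
# Conjecture S is false: the signed tree-polynomial law fails at every precision (OPTIMA T4(e))

HONEST FRAMING (venture CertifiedArithmetic / cell `pub-lowprec`): certified error envelopes and
provably optimal rounding/accumulation schemes for low-precision formats under stated cost models;
every table by two implementations; no hardware or vendor claims.

OPTIMA.md Theorem T4 (opt seat; `OptTreePoly`, `OptTreeWitness`, `OptTreePolyFormats`): for
NONNEGATIVE data of a format and every summation tree `t`, `s - ŝ ≤ (1 - 1/M_t(u))·s` with the
tree polynomial `M(leaf) = 1`, `M(node) = max + u·min`, attained under ties-to-even.  T4(e) /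
`paper/opt.tex` Thm. T4 ("scope and open part") CONJECTURED the same constant for SIGNED data:
`|ŝ - s| ≤ (1 - 1/M_t(u))·Σ|xᵢ|` for every tree whenever `(n-1)u ≤ 1/2` (CONJECTURE S; certificate
C13: `p = 4` all 47 shapes `n ≤ 8`, `p = 5` `n ≤ 7`, `p = 3` `n ≤ 7`, `p = 2` `n ≤ 5`; the known
failures all had `(n-1)u ≥ 7/8`).

THIS FILE REFUTES CONJECTURE S IN EVERY FORMAT OF PRECISION `p ≥ 4`, using the nine-term family of
`OptTreePolySigned.lean` (shape `τ₉ = ((((((·,·),·),((·,·),·)),·),·),·)`, `M_τ₉ = 1 + 6u + 2u²`,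
data `(-4M², -(2M+2), -2M, -4M², -(2M+2), 2M-1, 4M, 4M, 4M)·q`, `M = 2^m = 1/(2u)`):
`|ŝ - s| = (24M-5)q` against `Σ|xᵢ| = (8M²+20M+3)q`, i.e. the ratio `(24M-5)/(8M²+20M+3)`
`= u(12 - 5u)/(2 + 10u + 3u²) = 6u - 65u²/2 + O(u³)`, whereas the law is
`1 - 1/M_τ₉(u) = (6M+1)/(2M²+6M+1) = 6u - 34u² + O(u³)`; exactly,
`(24M-5)(2M²+6M+1) - (6M+1)(8M²+20M+3) = 6M² - 44M - 8 > 0 ⇔ M ≥ 8 ⇔ p ≥ 4`.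

* `signed_law_fails` — every format `α` with `m ≥ 3` whose range holds `8M²+16M` quanta (E4M3,
  bfloat16, binary16, binary32, the P3109 `binary8p4/p5`, …; NOT E2M3, whose 60 quanta are too
  few): `τ₉` is in-range data of `α` with `n = 9`, `(n-1)u_α = 8u_α ≤ 1/2`, and
  `(1 - 1/M_τ₉(u_α))·Σ|xᵢ| < |ŝ - s|`;
* `not_signed_treePoly_law` — hence the signed law (quantified over all in-range trees of `α` with
  `(n-1)u ≤ 1/2`) is false in every such format;
* `signed_law_fails_below_any_threshold` — for every `c > 0` some format (`wideFormat m`, `m`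
  large) has an in-range tree with `(n-1)u ≤ c` violating the law: NO hypothesis `(n-1)u ≤ c`
  repairs Conjecture S.  The two-sided signed worst case of a summation tree is NOT its tree
  polynomial — at any precision — although it agrees with it to first order (`6u` here; in general
  `M_t(u) = 1 + height·u + O(u²)`), and although the law IS right for nonnegative data (Theorem U)
  and for every caterpillar tree (`M = 1 + (n-1)u`: Lange–Rump, `AccumulateLangeRump`);
* kernel replays (third route; the structural proof above is the second, opt's DP the first):
  `e4m3_signed_family` (E4M3 at scale `1/2`: `ŝ = -320`, `s = -453/2`, ratio `187/675 > 49/177`),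
  `e4m3_signed_dp_witness` (implementation A's sharper E4M3 optimum for the same shape,
  `(-128, -9, -8, -72, -4, -9/2, -18, -16, 16)`: `153/551`), `bf16_signed_family`
  (`(-65536, -258, -256, -65536, -258, 255, 512, 512, 512)`: `3067/133635 > 769/33537`),
  each with `TreeInRange` decided by the Boolean checker `tirCheck` (`treeInRange_of_tirCheck`).

Found 2026-08-20 by running the opt seat's implementation A (`code/opt/treepoly/tree_poly_law_A.py`,
exact DP over reachable values, verbatim) one leaf further than certificate C13 (`p = 4`, `n = 9`:
one violating shape of 46), then reading the mechanism off the DP witnesses at `p = 5, 6`.  Which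
shapes fail for which `(p, n)` beyond that is implementation-A data (cell docs), not a theorem here.
-/

namespace Summit.Ventures.CertifiedArithmetic.LowPrec.Opt

open Literature.ComputerArithmetic.JeannerodRump2018
open Literature.ComputerArithmetic.JeannerodRump2018.SumTree
open Literature.ComputerArithmetic.FloatingPoint
open Literature.ComputerArithmetic.FloatingPoint.Format
open Literature.ComputerArithmetic.FloatingPoint.MiniFloat

/-! ## §1 Bookkeeping -/

/-- `τ₉` has nine leaves. -/
theorem length_leaves_signedTree9 (M q : ℚ) : (leaves (signedTree9 M q)).length = 9 := by
  simp [signedTree9, leaves]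

/-- The format's unit roundoff is `1/(2M)`, `M = 2^m`. -/
theorem unitRoundoff_eq_inv_two_mul (α : Format) :
    α.unitRoundoff = 1 / (2 * ((2 ^ α.manBits : ℕ) : ℚ)) := by
  rw [Format.unitRoundoff_eq, pow_succ]; push_cast; ring

/-- THE ARITHMETIC HEART: for `M ≥ 8` and `q > 0`,
`(1 - 1/(1 + 6u + 2u²))·(8M²+20M+3)q < (24M-5)q` with `u = 1/(2M)`
(equivalently `6M² - 44M - 8 > 0`). -/
theorem signed_family_ineq {M q : ℚ} (hM : 8 ≤ M) (hq : 0 < q) :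
    (1 - 1 / (1 + 6 * (1 / (2 * M)) + 2 * (1 / (2 * M)) ^ 2)) * ((8 * M ^ 2 + 20 * M + 3) * q)
      < (24 * M - 5) * q := by
  have hM0 : 0 < M := by linarith
  have hD : 0 < 2 * M ^ 2 + 6 * M + 1 := by positivity
  have key : 1 - 1 / (1 + 6 * (1 / (2 * M)) + 2 * (1 / (2 * M)) ^ 2)
      = (6 * M + 1) / (2 * M ^ 2 + 6 * M + 1) := by
    field_simp; ring
  rw [key, div_mul_eq_mul_div, div_lt_iff₀ hD]
  have hpoly : 0 < 6 * M ^ 2 - 44 * M - 8 := by nlinarith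
  nlinarith [mul_pos hq hpoly]

/-! ## §2 The refutation in every format of precision at least four -/

section Format

variable {α : Format}

/-- **CONJECTURE S FAILS IN FORMAT `α`** (`m ≥ 3`, range `8M²+16M ≤ maxScaled`): the nine-term tree
`τ₉` consists of data of `α`, every node of its evaluation is in range, `(n-1)·u_α = 8u_α ≤ 1/2`,
`|ŝ - s| = (24M-5)·q`, and `(1 - 1/M_τ₉(u_α))·Σ|xᵢ| < |ŝ - s|`. -/
theorem signed_law_fails (hm : 3 ≤ α.manBits)
    (hR : 8 * (2 ^ α.manBits) ^ 2 + 16 * 2 ^ α.manBits ≤ α.maxScaled) :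
    TreeInRange α (signedTree9 ((2 ^ α.manBits : ℕ) : ℚ) α.quantum) ∧
    (leaves (signedTree9 ((2 ^ α.manBits : ℕ) : ℚ) α.quantum)).length = 9 ∧
    (((leaves (signedTree9 ((2 ^ α.manBits : ℕ) : ℚ) α.quantum)).length : ℚ) - 1)
        * α.unitRoundoff ≤ 1 / 2 ∧
    |eval (flα α) (signedTree9 ((2 ^ α.manBits : ℕ) : ℚ) α.quantum)
        - exact (signedTree9 ((2 ^ α.manBits : ℕ) : ℚ) α.quantum)|
      = (24 * ((2 ^ α.manBits : ℕ) : ℚ) - 5) * α.quantum ∧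
    (1 - 1 / treeM α.unitRoundoff (signedTree9 ((2 ^ α.manBits : ℕ) : ℚ) α.quantum))
        * absLeafSum (signedTree9 ((2 ^ α.manBits : ℕ) : ℚ) α.quantum)
      < |eval (flα α) (signedTree9 ((2 ^ α.manBits : ℕ) : ℚ) α.quantum)
          - exact (signedTree9 ((2 ^ α.manBits : ℕ) : ℚ) α.quantum)| := by
  have h1 : 1 ≤ α.manBits := by omega
  have hq : 0 < α.quantum := α.quantum_pos
  have hM8 : (8 : ℚ) ≤ ((2 ^ α.manBits : ℕ) : ℚ) := by
    have : 2 ^ 3 ≤ 2 ^ α.manBits := Nat.pow_le_pow_right (by norm_num) hm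
    exact_mod_cast this
  have hu := unitRoundoff_eq_inv_two_mul α
  have herr : |eval (flα α) (signedTree9 ((2 ^ α.manBits : ℕ) : ℚ) α.quantum)
      - exact (signedTree9 ((2 ^ α.manBits : ℕ) : ℚ) α.quantum)|
        = (24 * ((2 ^ α.manBits : ℕ) : ℚ) - 5) * α.quantum := by
    rw [eval_signedTree9 h1 hR, exact_signedTree9]
    rw [show -((8 * ((2 ^ α.manBits : ℕ) : ℚ) ^ 2 + 16 * ((2 ^ α.manBits : ℕ) : ℚ)) * α.quantum)
        - -(8 * ((2 ^ α.manBits : ℕ) : ℚ) ^ 2 - 8 * ((2 ^ α.manBits : ℕ) : ℚ) + 5) * α.quantum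
        = -((24 * ((2 ^ α.manBits : ℕ) : ℚ) - 5) * α.quantum) by ring, abs_neg,
      abs_of_pos (by nlinarith)]
  refine ⟨treeInRange_signedTree9 h1 hR, length_leaves_signedTree9 _ _, ?_, herr, ?_⟩
  · rw [length_leaves_signedTree9, hu]
    push_cast at hM8 ⊢
    rw [show ((9 : ℚ) - 1) * (1 / (2 * 2 ^ α.manBits)) = 4 / 2 ^ α.manBits by field_simp; ring,
      div_le_iff₀ (by positivity)]
    linarith
  · rw [herr, treeM_signedTree9 α.unitRoundoff_pos.le, absLeafSum_signedTree9 (by linarith) hq, hu]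
    exact signed_family_ineq hM8 hq

/-- **THE SIGNED TREE-POLYNOMIAL LAW IS FALSE** in every format with `m ≥ 3` and range
`8M²+16M ≤ maxScaled`: it is NOT the case that every in-range tree with `(n-1)u ≤ 1/2` has
`|ŝ - s| ≤ (1 - 1/M_t(u))·Σ|xᵢ|`. -/
theorem not_signed_treePoly_law (hm : 3 ≤ α.manBits)
    (hR : 8 * (2 ^ α.manBits) ^ 2 + 16 * 2 ^ α.manBits ≤ α.maxScaled) :
    ¬ ∀ t : SumTree, TreeInRange α t → (((leaves t).length : ℚ) - 1) * α.unitRoundoff ≤ 1 / 2 →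
        |eval (flα α) t - exact t| ≤ (1 - 1 / treeM α.unitRoundoff t) * absLeafSum t := by
  intro h
  obtain ⟨hin, -, hn, -, hlt⟩ := signed_law_fails hm hR
  exact absurd (h _ hin hn) (not_le.mpr hlt)

end Format

/-! ## §3 No threshold `(n-1)u ≤ c` repairs it -/

/-- A format of precision `m+1` with ample exponent range (`emaxCode = m + 5`, no reserved top
codes): its largest magnitude is `2^m · 2^(m+4)` quanta. -/
def wideFormat (m : ℕ) : Format := ⟨m, 0, m + 5, 0, Nat.two_pow_pos m⟩

/-- `wideFormat m` holds the family: `8M² + 16M ≤ maxScaled` for `m ≥ 1`. -/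
theorem wideFormat_range {m : ℕ} (hm : 1 ≤ m) :
    8 * (2 ^ (wideFormat m).manBits) ^ 2 + 16 * 2 ^ (wideFormat m).manBits
      ≤ (wideFormat m).maxScaled := by
  have hM2 : 2 ≤ 2 ^ m := le_trans (by norm_num) (Nat.pow_le_pow_right (by norm_num : 0 < 2) hm)
  show 8 * (2 ^ m) ^ 2 + 16 * 2 ^ m ≤ Format.scaled (wideFormat m) (m + 5) 0
  rw [Format.scaled, if_neg (by omega)]
  show 8 * (2 ^ m) ^ 2 + 16 * 2 ^ m ≤ (2 ^ m + 0) * 2 ^ (m + 5 - 1)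
  rw [show m + 5 - 1 = m + 4 by omega, pow_add]
  nlinarith

/-- **NO RESTRICTION `(n-1)u ≤ c` RESCUES CONJECTURE S**: for every `c > 0` there are a format and
an in-range nine-leaf tree of its data with `(n-1)u ≤ c` whose two-sided error exceeds
`(1 - 1/M_t(u))·Σ|xᵢ|`. -/
theorem signed_law_fails_below_any_threshold (c : ℚ) (hc : 0 < c) :
    ∃ α : Format, ∃ t : SumTree, TreeInRange α t ∧
      (((leaves t).length : ℚ) - 1) * α.unitRoundoff ≤ c ∧
      (1 - 1 / treeM α.unitRoundoff t) * absLeafSum t < |eval (flα α) t - exact t| := by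
  obtain ⟨k, hk⟩ := pow_unbounded_of_one_lt (4 / c) (by norm_num : (1 : ℚ) < 2)
  set m := max k 3 with hm_def
  have hm3 : 3 ≤ m := le_max_right _ _
  have hR := wideFormat_range (m := m) (by omega)
  obtain ⟨hin, hlen, -, -, hlt⟩ := signed_law_fails (α := wideFormat m) hm3 hR
  refine ⟨wideFormat m, _, hin, ?_, hlt⟩
  rw [hlen, unitRoundoff_eq_inv_two_mul]
  have hpow : (4 : ℚ) / c < 2 ^ m :=
    lt_of_lt_of_le hk (pow_le_pow_right₀ (by norm_num) (le_max_left _ _))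
  have h2m : (0 : ℚ) < 2 ^ m := by positivity
  have h4 : (4 : ℚ) < 2 ^ m * c := (div_lt_iff₀ hc).mp hpow
  show (((9 : ℕ) : ℚ) - 1) * (1 / (2 * ((2 ^ m : ℕ) : ℚ))) ≤ c
  push_cast
  rw [show (((9 : ℚ)) - 1) * (1 / (2 * 2 ^ m)) = 4 / 2 ^ m by field_simp; ring,
    div_le_iff₀ h2m]
  linarith [mul_comm c ((2 : ℚ) ^ m)]

/-! ## §4 Kernel replays in E4M3 and bfloat16 -/

/-- Boolean checker for `TreeInRange`: leaves round to themselves, node arguments within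
`maxRat`. -/
def tirCheck (α : Format) : SumTree → Bool
  | .leaf x => decide ((roundNE α x).toRat = x)
  | .node l r => tirCheck α l && tirCheck α r &&
      decide (|eval (flα α) l + eval (flα α) r| ≤ α.maxRat)

/-- Soundness of the checker. -/
theorem treeInRange_of_tirCheck {α : Format} : ∀ t : SumTree, tirCheck α t = true → TreeInRange α t
  | .leaf x, h => by
      simp only [tirCheck, decide_eq_true_eq] at h
      exact ⟨roundNE α x, h⟩
  | .node l r, h => by
      simp only [tirCheck, Bool.and_eq_true, decide_eq_true_eq] at h
      exact ⟨treeInRange_of_tirCheck l h.1.1, treeInRange_of_tirCheck r h.1.2, h.2⟩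

/-- E4M3 (`m = 3`, `M = 8`, `u = 1/16`), the family at scale `1/2`:
data `(-128, -9, -8, -128, -9, 15/2, 16, 16, 16)`, all E4M3 values, every node in range;
the format computes `ŝ = -320` while `s = -453/2`: `|ŝ - s| = 187/2`, `Σ|xᵢ| = 675/2`, ratio
`187/675 = 0.27704 > 49/177 = 0.27684 = 1 - 1/M_τ₉(1/16)` although `(n-1)u = 1/2`. -/
theorem e4m3_signed_family :
    TreeInRange Format.E4M3 (signedTree9 8 (1 / 2)) ∧
    eval (flα Format.E4M3) (signedTree9 8 (1 / 2)) = -320 ∧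
    exact (signedTree9 8 (1 / 2)) = -453 / 2 ∧
    absLeafSum (signedTree9 8 (1 / 2)) = 675 / 2 ∧
    1 - 1 / treeM Format.E4M3.unitRoundoff (signedTree9 8 (1 / 2)) = 49 / 177 ∧
    (49 / 177 : ℚ) * (675 / 2) < |(-320 : ℚ) - (-453 / 2)| := by
  have hu : Format.E4M3.unitRoundoff = 1 / 16 := by rw [Format.unitRoundoff_eq]; rfl
  refine ⟨treeInRange_of_tirCheck _ (by decide +kernel), by decide +kernel, ?_, ?_, ?_, ?_⟩
  · rw [exact_signedTree9]; norm_num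
  · rw [absLeafSum_signedTree9 (by norm_num) (by norm_num)]; norm_num
  · rw [treeM_signedTree9 (by rw [hu]; norm_num), hu]; norm_num
  · norm_num [abs_of_neg]

/-- E4M3, implementation A's optimum for the shape `τ₉` (`tree_poly_law_A.py 4 8 9 even net`):
data `(-128, -9, -8, -72, -4, -9/2, -18, -16, 16)` — all E4M3 values, nodes in range — give
`ŝ = -320`, `s = -487/2`, `Σ|xᵢ| = 551/2`: ratio `153/551 = 0.27768`, above the family's `187/675`
and the law's `49/177`. -/
theorem e4m3_signed_dp_witness :
    let t : SumTree := .node (.node (.node (.node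
        (.node (.node (.leaf (-128)) (.leaf (-9))) (.leaf (-8)))
        (.node (.node (.leaf (-72)) (.leaf (-4))) (.leaf (-9 / 2))))
      (.leaf (-18))) (.leaf (-16))) (.leaf 16)
    TreeInRange Format.E4M3 t ∧ eval (flα Format.E4M3) t = -320 ∧ exact t = -487 / 2 ∧
    absLeafSum t = 551 / 2 ∧ treeM Format.E4M3.unitRoundoff t = 177 / 128 ∧
    (1 - 1 / (177 / 128) : ℚ) * (551 / 2) < |(-320 : ℚ) - (-487 / 2)| := by
  have hu : Format.E4M3.unitRoundoff = 1 / 16 := by rw [Format.unitRoundoff_eq]; rfl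
  refine ⟨treeInRange_of_tirCheck _ (by decide +kernel), by decide +kernel, ?_, ?_, ?_, ?_⟩
  · simp only [exact]; norm_num
  · simp only [absLeafSum]; norm_num [abs_of_neg, abs_of_pos]
  · simp only [treeM_node, treeM_leaf, hu]; norm_num
  · norm_num [abs_of_neg]

/-- bfloat16 (`m = 7`, `M = 128`, `u = 2^-8`), the family at unit scale:
data `(-65536, -258, -256, -65536, -258, 255, 512, 512, 512)`, all bfloat16 values, nodes in range;
`ŝ = -133120`, `s = -130053`, `Σ|xᵢ| = 133635`: ratio `3067/133635 = 0.0229506 > 769/33537 =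
0.0229299 = 1 - 1/M_τ₉(2^-8)`, with `(n-1)u = 1/32`. -/
theorem bf16_signed_family :
    TreeInRange Format.BFloat16 (signedTree9 128 1) ∧
    eval (flα Format.BFloat16) (signedTree9 128 1) = -133120 ∧
    exact (signedTree9 128 1) = -130053 ∧
    absLeafSum (signedTree9 128 1) = 133635 ∧
    1 - 1 / treeM Format.BFloat16.unitRoundoff (signedTree9 128 1) = 769 / 33537 ∧
    (769 / 33537 : ℚ) * 133635 < |(-133120 : ℚ) - (-130053)| := by
  have hu : Format.BFloat16.unitRoundoff = 1 / 256 := by rw [Format.unitRoundoff_eq]; rfl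
  refine ⟨treeInRange_of_tirCheck _ (by decide +kernel), by decide +kernel, ?_, ?_, ?_, ?_⟩
  · rw [exact_signedTree9]; norm_num
  · rw [absLeafSum_signedTree9 (by norm_num) (by norm_num)]; norm_num
  · rw [treeM_signedTree9 (by rw [hu]; norm_num), hu]; norm_num
  · norm_num [abs_of_neg]

end Summit.Ventures.CertifiedArithmetic.LowPrec.Opt
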